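import Literature.MathematicalPhysics.QuantumLattice.HeisenbergRPCorrelationBlocks
import HarnessLib

/-!
# Reflection symmetry of the ground-state two-point function of the torus antiferromagnet

The Heisenberg antiferromagnet `H_L = Σ_{⟨xy⟩} 𝐒_x·𝐒_y` on the discrete torus `(ℤ/Lℤ)^d`
(`heisenbergTorus d L n 1`) is invariant under every automorphism of the torus graph, hence so is
its tracial ground-state two-point function `Gᵅ_L(x, y)` (`heisGroundCorr`): translations
(`heisGroundCorr_add_right`), axis permutations (`heisGroundCorr_comp_perm`) and inversion are in the
tree; this file adds the general statement for a graph automorphism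
(`heisGroundCorr_equiv_of_adj_iff`) and the REFLECTION of one coordinate axis `xᵢ ↦ -xᵢ`
(`torusReflect`, `heisGroundCorr_torusReflect`), in particular the residue form
`c(a, b) = c((L - a mod L) mod L, b)` of the reduced correlation function
`c(a,b) = ⟨Sᶻ_0 Sᶻ_(a,b)⟩` of the square torus (`heisRedCorr2_reflect_mod`), which together with
`heisRedCorr2_swap` generates the full point group `D₄` of the square torus (used by the finite-volume
linear programmes over `c(a,b)` of the HubbardLadder R2 rows). Kennedy–Lieb–Shastry (1988) use the
lattice symmetry of `g_q` / `G(x,y)` throughout (J. Stat. Phys. 53, p. 1021, "by the symmetry of the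
lattice"); Dyson–Lieb–Simon (1978) §4 likewise. [cite: KLS1988JSP, p. 1021] [cite: DLS1978, §4]
-/

noncomputable section

open Matrix Finset Literature.Probability.LatticeModels
open Literature.MathematicalPhysics.QuantumLattice Literature.MathematicalPhysics.QuantumLattice.SpinOperators

namespace Literature.MathematicalPhysics.QuantumLattice

variable {d : ℕ} (L : ℕ) [NeZero L] (n : ℕ)

/-! ### Invariance under graph automorphisms of the torus -/

/-- **The torus antiferromagnet is invariant under every automorphism of the torus graph**
(site relabelling `x ↦ π x`, acting on tensor indices by `σ ↦ σ ∘ π`; the edge sum is reindexed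
along `Sym2.map π`). [cite: KLS1988JSP, p. 1021] -/
theorem heisenbergTorus_submatrix_comp_equiv_of_adj_iff (π : TorusSite d L ≃ TorusSite d L)
    (hπ : ∀ x y, (torusGraph d L).Adj (π x) (π y) ↔ (torusGraph d L).Adj x y) :
    (heisenbergTorus d L n 1).submatrix
        (fun σ : TensorIndex (TorusSite d L) (n + 1) => σ ∘ π) (fun σ => σ ∘ π) =
      heisenbergTorus d L n 1 := by
  rw [heisenbergTorus_one_eq_sum, submatrix_finset_sum]
  refine Finset.sum_nbij' (Sym2.map π) (Sym2.map π.symm) (fun e he => ?_) (fun e he => ?_)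
    (fun e _ => ?_) (fun e _ => ?_) (fun e _ => ?_)
  · induction e using Sym2.ind with
    | h x y =>
      rw [SimpleGraph.mem_edgeFinset, SimpleGraph.mem_edgeSet] at he
      rw [Sym2.map_mk, SimpleGraph.mem_edgeFinset, SimpleGraph.mem_edgeSet, hπ]
      exact he
  · induction e using Sym2.ind with
    | h x y =>
      rw [SimpleGraph.mem_edgeFinset, SimpleGraph.mem_edgeSet] at he
      rw [Sym2.map_mk, SimpleGraph.mem_edgeFinset, SimpleGraph.mem_edgeSet, ← hπ,
        Equiv.apply_symm_apply, Equiv.apply_symm_apply]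
      exact he
  · simp only [Sym2.map_map, Equiv.symm_comp_self, Sym2.map_id', id_eq]
  · simp only [Sym2.map_map, Equiv.self_comp_symm, Sym2.map_id', id_eq]
  · induction e using Sym2.ind with
    | h x y =>
      simp only [Sym2.map_mk, spinDotSym_mk, spinDot, submatrix_finset_sum, spinBond_submatrix_comp]

/-- **The ground-state two-point function is invariant under every automorphism of the torus
graph**: `Gᵅ(π x, π y) = Gᵅ(x, y)`. [cite: KLS1988JSP, p. 1021] -/
theorem heisGroundCorr_equiv_of_adj_iff (π : TorusSite d L ≃ TorusSite d L)
    (hπ : ∀ x y, (torusGraph d L).Adj (π x) (π y) ↔ (torusGraph d L).Adj x y)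
    (α : Fin 3) (x y : TorusSite d L) :
    heisGroundCorr α L n (π x) (π y) = heisGroundCorr α L n x y := by
  rw [heisGroundCorr_of_neZero, heisGroundCorr_of_neZero, ← siteSpin_submatrix_comp n π x α,
    ← siteSpin_submatrix_comp n π y α,
    ← Matrix.submatrix_mul _ _ _ _ _ (bijective_comp_equiv (q := n + 1) π),
    groundStateFunctional_submatrix_comp (heisenbergTorus_isHermitian d L n 1) π
      (heisenbergTorus_submatrix_comp_equiv_of_adj_iff L n π hπ)]

/-! ### The reflection of one axis -/

/-- The reflection `xᵢ ↦ -xᵢ` of the `i`-th coordinate of the torus `(ℤ/Lℤ)^d` (the other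
coordinates fixed), as a permutation of the sites. [cite: DLS1978, §4] -/
def torusReflect (i : Fin d) : Equiv.Perm (TorusSite d L) :=
  Function.Involutive.toPerm (fun x : TorusSite d L => Function.update x i (-x i)) (by
    intro x
    ext j
    by_cases hj : j = i
    · subst hj; simp
    · simp [hj])

omit [NeZero L] in
/-- Unfolding lemma. [folklore] -/
private theorem torusReflect_apply (i : Fin d) (x : TorusSite d L) :
    torusReflect L i x = Function.update x i (-x i) := rfl

omit [NeZero L] in
/-- The reflection is additive. [folklore] -/
private theorem torusReflect_add (i : Fin d) (x y : TorusSite d L) :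
    torusReflect L i (x + y) = torusReflect L i x + torusReflect L i y := by
  ext j
  by_cases hj : j = i
  · subst hj; simp [torusReflect_apply, add_comm]
  · simp [torusReflect_apply, hj]

omit [NeZero L] in
/-- The reflection on the unit vectors: `eⱼ ↦ eⱼ` (`j ≠ i`), `eᵢ ↦ -eᵢ`. [folklore] -/
private theorem torusReflect_single (i j : Fin d) :
    torusReflect L i (Pi.single j (1 : ZMod L)) =
      if j = i then -Pi.single i (1 : ZMod L) else Pi.single j 1 := by
  ext k
  by_cases hji : j = i
  · subst hji
    by_cases hk : k = j
    · subst hk; simp [torusReflect_apply]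
    · simp [torusReflect_apply, hk]
  · rw [if_neg hji]
    by_cases hk : k = i
    · subst hk
      have hjk : j ≠ k := hji
      simp [torusReflect_apply, hjk.symm]
    · simp [torusReflect_apply, hk]

omit [NeZero L] in
/-- One direction of the invariance of adjacency under the reflection. [folklore] -/
private theorem torusGraph_adj_torusReflect_of_adj (i : Fin d) {x y : TorusSite d L}
    (h : (torusGraph d L).Adj x y) :
    (torusGraph d L).Adj (torusReflect L i x) (torusReflect L i y) := by
  rw [torusGraph_adj_iff] at h ⊢
  obtain ⟨hne, hor⟩ := h
  refine ⟨fun h => hne ((torusReflect L i).injective h), ?_⟩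
  -- `y = x + eⱼ ↦ θy = θx + θeⱼ`, and `θeᵢ = -eᵢ` swaps the two disjuncts
  rcases hor with ⟨j, rfl⟩ | ⟨j, rfl⟩
  · by_cases hji : j = i
    · right
      refine ⟨i, ?_⟩
      rw [torusReflect_add, torusReflect_single, if_pos hji, neg_add_cancel_right]
    · left
      exact ⟨j, by rw [torusReflect_add, torusReflect_single, if_neg hji]⟩
  · by_cases hji : j = i
    · left
      refine ⟨i, ?_⟩
      rw [torusReflect_add, torusReflect_single, if_pos hji, neg_add_cancel_right]
    · right
      exact ⟨j, by rw [torusReflect_add, torusReflect_single, if_neg hji]⟩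

omit [NeZero L] in
/-- **The reflection of an axis is an automorphism of the torus graph.** [cite: DLS1978, §4] -/
theorem torusGraph_adj_torusReflect_iff (i : Fin d) (x y : TorusSite d L) :
    (torusGraph d L).Adj (torusReflect L i x) (torusReflect L i y) ↔ (torusGraph d L).Adj x y := by
  refine ⟨fun h => ?_, torusGraph_adj_torusReflect_of_adj L i⟩
  have h' := torusGraph_adj_torusReflect_of_adj L i h
  have hinv : ∀ z : TorusSite d L, torusReflect L i (torusReflect L i z) = z := fun z =>
    Function.Involutive.toPerm_involutive _ z
  rwa [hinv, hinv] at h'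

/-- **Reflection symmetry of the two-point function**: `Gᵅ(θᵢ x, θᵢ y) = Gᵅ(x, y)` for the
reflection `θᵢ` of the `i`-th axis. [cite: KLS1988JSP, p. 1021] [cite: DLS1978, §4] -/
theorem heisGroundCorr_torusReflect (i : Fin d) (α : Fin 3) (x y : TorusSite d L) :
    heisGroundCorr α L n (torusReflect L i x) (torusReflect L i y) = heisGroundCorr α L n x y :=
  heisGroundCorr_equiv_of_adj_iff L n (torusReflect L i) (torusGraph_adj_torusReflect_iff L i) α x y

/-- Reflection symmetry of the reduced correlation function of the square torus, in residues:
`c(a, b) = c((L - a mod L) mod L, b)` (reflection of the first axis; with `heisRedCorr2_swap` this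
generates the point group `D₄`). [cite: KLS1988JSP, p. 1021] -/
theorem heisRedCorr2_reflect_mod (a b : ℕ) :
    heisRedCorr2 L n a b = heisRedCorr2 L n ((L - a % L) % L) b := by
  have hneg : -((a : ℕ) : ZMod L) = ((L - a % L : ℕ) : ZMod L) := by
    rw [Nat.cast_sub (Nat.mod_lt a (Nat.pos_of_ne_zero (NeZero.ne L))).le, ZMod.natCast_self,
      ZMod.natCast_mod, zero_sub]
  rw [heisRedCorr2, heisRedCorr2, ZMod.natCast_mod, ← hneg,
    ← heisGroundCorr_torusReflect L n (0 : Fin 2) 0 0 ![(a : ZMod L), (b : ZMod L)]]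
  congr 1
  · ext j
    by_cases hj : j = 0
    · subst hj; simp [torusReflect_apply]
    · simp [torusReflect_apply, hj]
  · ext j
    fin_cases j <;> simp [torusReflect_apply]

/-- Reflection of the second axis: `c(a, b) = c(a, (L - b mod L) mod L)`. [cite: KLS1988JSP, p. 1021] -/
theorem heisRedCorr2_reflect_snd_mod (a b : ℕ) :
    heisRedCorr2 L n a b = heisRedCorr2 L n a ((L - b % L) % L) := by
  rw [heisRedCorr2_swap L n a b, heisRedCorr2_reflect_mod L n b a, heisRedCorr2_swap]

end Literature.MathematicalPhysics.QuantumLattice
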